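import Mathlib.GroupTheory.QuotientGroup.Defs
import Literature.NumberTheory.EllipticCurves.IwasawaSelmer
import Literature.NumberTheory.GaloisRepresentations.LocalGaloisGroup
import Literature.NumberTheory.Automorphic.AdicCompletionLocalField
import HarnessLib

/-!
# Greenberg's Selmer group of a discrete Galois module over `L = K̄^H` (e.g. `L = K_∞`)

Let `K` be a number field, `Γ_K = Gal(K̄/K)`, `p` a prime, `M` a discrete abelian group with a
`Γ_K`-action (`[DistribMulAction Γ_K M]`; intended: `M = A = T ⊗ Frac(𝒪)/𝒪` for a `Γ_K`-stable
lattice `T` in a `p`-adic Galois representation, "`A_p = V_p/T_p` which as a group is just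
`(ℚ_p/ℤ_p)^d`", Greenberg 1989, p. 98) and `H ≤ Γ_K` a normal subgroup with fixed field `L = K̄^H`
(intended: `H = ker κ = Gal(K̄/K_∞)` for a `ℤ_p`-extension `κ : ZpExtension K p`, file
`ZpExtension`). Given, at each place `v ∣ p` of `K`, an **ordinary local datum** — a subgroup
`M⁺_v ≤ M` stable under the decomposition group `D_v ≤ Γ_K` of the chosen prime of `K̄` above `v`
("`F⁺A_p`, its image in `A_p`", Greenberg 1989 (4); "`A'_{f,i}` (resp. `A''_{f,i}`) for the
submodule (resp. quotient module)", Emerton–Pollack–Weston 2006, §3.1) — this file defines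
**Greenberg's Selmer group**

  `Sel(L, M) = ker ( H¹(L, M) → ∏_{w ∤ p} H¹(L_w, M) × ∏_{w ∣ p} H¹(I_w, M/M⁺_w) )`

(Emerton–Pollack–Weston, Invent. Math. 163 (2006), §3.1, "Following [Greenberg 1989]":
`H¹_s(ℚ_{∞,v}, A) = H¹(ℚ_{∞,v}, A)` for `v ≠ v_p` and
`H¹_s(ℚ_{∞,v_p}, A) = im (H¹(ℚ_{∞,v_p}, A) → H¹(I_{v_p}, A''))`,
`Sel(ℚ_∞, A) = ker (H¹(ℚ_∞, A) → ∏_v H¹_s(ℚ_{∞,v}, A))`, the product over *all* places `v` of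
`ℚ_∞`; Greenberg, Adv. Stud. Pure Math. 17 (1989), p. 98, (2)–(4): "locally trivial at all places
`v` of `ℚ_∞`", at `v ∤ p` (including the infinite places) via `H¹(ℚ_∞, A) → H¹(I_v, A)` — "one could
replace `I_v` by `D_v` since `D_v/I_v` has (profinite) order prime to `p`" — and at `v_p` via
`H¹(ℚ_∞, A) → H¹(I_{v_p}, A) → H¹(I_{v_p}, A/F⁺A)`; Skinner–Urban 2014, §3.1.3), as an
`AddSubgroup` of the tree's `H¹(H, M) = Literature.NumberTheory.EllipticCurves.subgroupH1 H M`
(file `SubgroupSelmer`, part (a): Mathlib's `continuousCohomology 1` of the subgroup `H` with the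
restricted action), exactly in the style of `WeierstrassCurve.selmerGroupOver` (same file): the
places `w` of `L` above a place `v` of `K` are the `Γ_K`-conjugates (modulo `H`) of the chosen
decomposition group, so each local condition is imposed after conjugating by every `σ ∈ Γ_K`
(`conjH1 H M σ`) — at `v ∣ p` this transports the datum `M⁺_v` to `σ⁻¹ M⁺_v` at the conjugate prime
("The definition is easily seen to be independent of the choice of places of `ℚ̄`", Greenberg 1989,
p. 98).

## Main definitions (namespace `Literature.NumberTheory.EllipticCurves.GreenbergSelmer`)

* `decomp v`, `inertia v`, `decompInf w ≤ Γ_K`: the decomposition / inertia group of the prime of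
  `K̄` above the finite place `v` (resp. infinite place `w`) cut out by the tree's chosen embedding
  `K̄ → \bar K_v` — by definition the image of `Γ_{K_v}` (resp. of `absInertia K_v`) under
  `absGaloisRestrict K K_v` (file `GaloisRepresentations/AbsGaloisGroup`); that these ARE the
  decomposition and inertia groups `D_{𝔓₀}`, `I_{𝔓₀}` of the prime `𝔓₀ = adicCompletionPrime K v` is
  `decompositionSubgroup_adicCompletionPrime_eq_range` / `inertia_adicCompletionPrime_eq_map_absInertia`
  (file `GaloisRepresentations/DecompositionGroupOfCompletion`, Neukirch II (9.6)); the same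
  restriction map defines `GaloisRep.toLocal`, hence `FramedGaloisRep.IsOrdinaryOfWeightAt`.
* `LocalDatum K M v`: an ordinary local datum at `v` — a subgroup `plus = M⁺_v ≤ M` stable under
  `D_v`; `N.Gr = M ⧸ M⁺_v` (the quotient "`A''`", discrete, with its `D_v`-action
  `LocalDatum.instDistribMulActionGr`); `Data K M p` = a local datum at every `v ∣ p`.
* `inertiaIn H v`, `decompIn H v ≤ D_v`: the inertia / decomposition group *of `L`* at the place
  above `v`, `H ⊓ I_v` and `H ⊓ D_v`, as subgroups of `D_v` (so that they act on `M ⧸ M⁺_v`).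
* `N.greenbergMap H : H¹(H, M) →+ H¹(H ⊓ I_v, M ⧸ M⁺_v)` and its kernel `N.greenbergKer H`
  (Greenberg's condition (4)); `N.strictMap H` / `N.strictKer H` (the same with `D_v` for `I_v`:
  Greenberg's "strict" Selmer condition, p. 98; `strictKer_le_greenbergKer`); `awayKer H M v`,
  `infKer H M w` (the conditions `res = 0` in `H¹(H ⊓ D_v, M)` at `v ∤ p` and at infinite `w`).
* **`selmerGroupOver H M p L`** = `Sel(L, M)` and **`strictSelmerGroupOver H M p L`** (Greenberg's
  strict Selmer group, `≤ Sel`, `strictSelmerGroupOver_le`); `mem_selmerGroupOver_iff`;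
  **`conjH1_mem_selmerGroupOver`** (`Sel` is stable under the conjugation action of `Γ_K`, PROVED
  from `conjH1_mul_holds`) and **`scalarH1_mem_selmerGroupOver`** (`Sel` is stable under the
  scalars preserving the data, PROVED) — the two stabilities that the hypothesis structure
  `WeierstrassCurve.SelmerDualData` had to carry as the field `conj_mem`.
* `selmerInfty κ M L = Sel(K_∞, M)` for a `ℤ_p`-extension `κ` (`H = ker κ`), the object dual to the
  Iwasawa module of Greenberg 1989 / Emerton–Pollack–Weston §3.1; the conjugation action of
  `γ ∈ Γ_K` on it is the tree's `conjH1 κ.kerSubgroup M γ`.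
* `scalarH1 H M r : H¹(H, M) →+ H¹(H, M)` (generic: any topological group `G`, `H ≤ G`): the
  endomorphism induced by a scalar `r ∈ R` acting on `M` and commuting with `G` (functoriality of
  `H¹` in the coefficients; `scalarH1_one`, `scalarH1_mul`) — the `𝒪`-module structure of
  `H¹(K_∞, A)` for an `𝒪`-module `A`, used by the `Λ_𝒪`-dual data of the newform file
  `GreenbergSelmerNewform`.

## Design notes

* Everything is a definition with a body or a proved unfolding/API lemma; no fact is vendored.
* Generic layer reused verbatim from `SubgroupSelmer` §(a) (`subgroupH1`, `resOfLe`, `conjH1`,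
  `resH1Hom`): same universe convention (`K M : Type u`), `noncomputable section`,
  `open scoped Classical`.
* The `D_v`-action on `M ⧸ M⁺_v` is constructed here (`QuotientAddGroup.map`; Mathlib only has
  quotient actions compatible with a scalar tower, `Submodule.Quotient.distribMulAction'`), on the
  type synonym `LocalDatum.Gr` so that no global instance on `M ⧸ _` is declared.
* At `v ∤ p` the condition is Emerton–Pollack–Weston's (`H¹(L_w, M)`, decomposition group), which by
  Greenberg's remark quoted above defines the same group as his (inertia group) for `p`-primary `M`
  over the cyclotomic tower; infinite places are included, as in both sources (for odd `p` and
  `p`-primary `M` they impose nothing).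
* What is NOT here: `Λ`-module structures and duals (newform file), control theorems, the
  comparison with `WeierstrassCurve.selmerInfty` for `M = E[p^∞]` (Greenberg, LNM 1716, Prop. 2.4;
  Skinner 2016 §3.2), cotorsion results (Kato; EPW Thm. 3.1.1) — none is asserted.

## References

* R. Greenberg, *Iwasawa theory for p-adic representations*, Adv. Stud. Pure Math. 17 (1989),
  97–137, §1 p. 98 (1)–(4). [Greenberg1989]
* M. Emerton, R. Pollack, T. Weston, *Variation of Iwasawa invariants in Hida families*, Invent.
  Math. 163 (2006), §3.1 (arXiv:math/0404484, p. 17 of the held text). [EmertonPollackWeston2006]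
* C. Skinner, E. Urban, *The Iwasawa main conjectures for GL₂*, Invent. Math. 195 (2014), §3.1.3.
  [SkinnerUrban2014]
* R. Greenberg, *Iwasawa theory for elliptic curves*, LNM 1716 (1999), §2. [GreenbergLNM1716]
-/

noncomputable section

open scoped Classical

open NumberField IsDedekindDomain Field
open Literature.NumberTheory.GaloisRepresentations

universe u

namespace Literature.NumberTheory.EllipticCurves.GreenbergSelmer

variable {K : Type u} [Field K] [NumberField K]

/-! ## Decomposition and inertia groups at a place, for the chosen embedding -/

/-- The **decomposition group `D_v ≤ Γ_K`** at the finite place `v` for the tree's chosen embedding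
`K̄ → \bar K_v`: the image of `Γ_{K_v} → Γ_K` (`absGaloisRestrict K K_v`, `K_v = v.adicCompletion K`).
It is the decomposition group of the prime `𝔓₀ = adicCompletionPrime K v` of `\bar ℤ_K`
(`decompositionSubgroup_adicCompletionPrime_eq_range`, Neukirch II (9.6)).
Greenberg 1989, p. 98 ("choose a place of `ℚ̄` over `v` and let `I_v` and `D_v` denote the inertia
and decomposition group"). [cite: Greenberg1989, §1 p. 98] -/
def decomp (v : HeightOneSpectrum (𝓞 K)) : Subgroup (absoluteGaloisGroup K) :=
  (absGaloisRestrict K (v.adicCompletion K)).toMonoidHom.range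

/-- The **inertia group `I_v ≤ Γ_K`** at the finite place `v` for the chosen embedding: the image of
the local inertia group `absInertia K_v ≤ Γ_{K_v}` under `absGaloisRestrict K K_v`. It is the inertia
group of `𝔓₀ = adicCompletionPrime K v` (`inertia_adicCompletionPrime_eq_map_absInertia`).
Greenberg 1989, p. 98. [cite: Greenberg1989, §1 p. 98] -/
def inertia (v : HeightOneSpectrum (𝓞 K)) : Subgroup (absoluteGaloisGroup K) :=
  (absInertia (v.adicCompletion K)).map (absGaloisRestrict K (v.adicCompletion K)).toMonoidHom

/-- The decomposition group at an infinite place `w` (order `≤ 2`): the image of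
`Γ_{K_w} → Γ_K`, `K_w = w.Completion`. Greenberg 1989, p. 98 ("including the infinite places").
[cite: Greenberg1989, §1 p. 98] -/
def decompInf (w : InfinitePlace K) : Subgroup (absoluteGaloisGroup K) :=
  (absGaloisRestrict K w.Completion).toMonoidHom.range

omit [NumberField K] in
/-- Membership in `D_v`: `δ = res σ` for some `σ ∈ Γ_{K_v}` (Neukirch II (9.6): the decomposition
group is the image of the local Galois group). [cite: NeukirchANT1999, Ch. II §9 Prop. (9.6)] -/
theorem mem_decomp_iff [NumberField K] (v : HeightOneSpectrum (𝓞 K)) (δ : absoluteGaloisGroup K) :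
    δ ∈ decomp v ↔ ∃ σ : absoluteGaloisGroup (v.adicCompletion K),
      absGaloisRestrict K (v.adicCompletion K) σ = δ :=
  Iff.rfl

/-- `I_v ≤ D_v` (the inertia group is a subgroup of the decomposition group).
[cite: NeukirchANT1999, Ch. I §9 (Def. (9.5), `I_𝔓 ⊆ G_𝔓`)] -/
theorem inertia_le_decomp (v : HeightOneSpectrum (𝓞 K)) : inertia v ≤ decomp (K := K) v := by
  rintro _ ⟨σ, -, rfl⟩
  exact ⟨σ, rfl⟩

/-! ## Ordinary local data `M⁺_v ≤ M` and the quotient `M ⧸ M⁺_v` -/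

variable (K) in
/-- An **ordinary local datum** at the finite place `v` (intended `v ∣ p`) for the discrete
`Γ_K`-module `M`: a subgroup `plus = M⁺_v ≤ M` stable under the decomposition group `D_v` of the
chosen prime above `v`, i.e. under `res σ` for every `σ ∈ Γ_{K_v}`. Greenberg 1989, p. 98, (1)(b) and
(4): "`F⁺V_p` is invariant for the action of `G_{ℚ_p}` … we define `F⁺V_p = F¹V_p` and `F⁺A_p` is its
image in `A_p`"; Emerton–Pollack–Weston 2006, §3.1, (eq:ordes): the `𝒪[G_p]`-submodule `A'_{f,i}`.
[cite: Greenberg1989, §1 p. 98 (1), (4)] -/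
structure LocalDatum (M : Type u) [AddCommGroup M] [DistribMulAction (absoluteGaloisGroup K) M]
    (v : HeightOneSpectrum (𝓞 K)) where
  /-- The `D_v`-stable subgroup `M⁺_v ≤ M`. -/
  plus : AddSubgroup M
  /-- `M⁺_v` is stable under the decomposition group at the chosen prime above `v`. -/
  smul_mem : ∀ (σ : absoluteGaloisGroup (v.adicCompletion K)) {m : M}, m ∈ plus →
    absGaloisRestrict K (v.adicCompletion K) σ • m ∈ plus

variable (K) in
/-- **Ordinary data above `p`**: an ordinary local datum at every finite place `v` with `p ∈ v`
(cf. `DiscreteGaloisModule.LocalConditionsAbove`). Greenberg 1989, p. 98.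
[cite: Greenberg1989, §1 p. 98] -/
abbrev Data (M : Type u) [AddCommGroup M] [DistribMulAction (absoluteGaloisGroup K) M] (p : ℕ) :
    Type u :=
  ∀ v : HeightOneSpectrum (𝓞 K), ((p : ℕ) : 𝓞 K) ∈ v.asIdeal → LocalDatum K M v

namespace LocalDatum

variable {M : Type u} [AddCommGroup M] [DistribMulAction (absoluteGaloisGroup K) M]
  {v : HeightOneSpectrum (𝓞 K)} (N : LocalDatum K M v)

/-- `M⁺_v` is stable under every element of `D_v` ("`F⁺V_p` is invariant for the action of
`G_{ℚ_p}`"). [cite: Greenberg1989, §1 p. 98 (1)(b)] -/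
theorem smul_mem_of_mem_decomp {δ : absoluteGaloisGroup K} (hδ : δ ∈ decomp v) {m : M}
    (hm : m ∈ N.plus) : δ • m ∈ N.plus := by
  obtain ⟨σ, rfl⟩ := hδ
  exact N.smul_mem σ hm

/-- The quotient `M ⧸ M⁺_v` of the ordinary local datum ("`A/F⁺A`", Greenberg 1989 (4); "`A''`",
EPW §3.1), a type synonym carrying the discrete topology and the induced `D_v`-action.
[cite: Greenberg1989, §1 p. 98 (4)] -/
def Gr : Type u := M ⧸ N.plus

/-- `M ⧸ M⁺_v` is an abelian group (instance plumbing). [folklore] -/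
instance instAddCommGroupGr : AddCommGroup N.Gr := inferInstanceAs (AddCommGroup (M ⧸ N.plus))

/-- `M ⧸ M⁺_v` carries the discrete topology. [folklore] -/
instance instTopologicalSpaceGr : TopologicalSpace N.Gr := ⊥

/-- `M ⧸ M⁺_v` is discrete. [folklore] -/
instance instDiscreteTopologyGr : DiscreteTopology N.Gr := ⟨rfl⟩

/-- The quotient map `M → M ⧸ M⁺_v` ("`F⁺A_p` is its image in `A_p`", the map `A → A/F⁺A` of (4)).
[cite: Greenberg1989, §1 p. 98 (4)] -/
def grMk : M →+ N.Gr := QuotientAddGroup.mk' N.plus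

/-- The quotient map `M → M ⧸ M⁺_v` is surjective. [cite: Greenberg1989, §1 p. 98 (4)] -/
theorem grMk_surjective : Function.Surjective N.grMk :=
  QuotientAddGroup.mk'_surjective N.plus

/-- The kernel of `M → M ⧸ M⁺_v` is `M⁺_v`. [cite: Greenberg1989, §1 p. 98 (4)] -/
theorem ker_grMk : N.grMk.ker = N.plus :=
  QuotientAddGroup.ker_mk' N.plus

/-- The endomorphism of `M ⧸ M⁺_v` induced by `δ ∈ D_v` (`QuotientAddGroup.map` of `m ↦ δ • m`,
well defined by `smul_mem_of_mem_decomp`): the `D_v`-module structure of `A/F⁺A` in (4).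
[cite: Greenberg1989, §1 p. 98 (4)] -/
def grSMulHom (δ : decomp v) : N.Gr →+ N.Gr :=
  QuotientAddGroup.map N.plus N.plus (DistribSMul.toAddMonoidHom M (δ : absoluteGaloisGroup K))
    fun _ hm ↦ N.smul_mem_of_mem_decomp δ.2 hm

/-- `grSMulHom δ` on classes: `δ · (m mod M⁺) = (δ • m) mod M⁺`. [cite: Greenberg1989, §1 p. 98 (4)] -/
@[simp]
theorem grSMulHom_grMk (δ : decomp v) (m : M) :
    N.grSMulHom δ (N.grMk m) = N.grMk ((δ : absoluteGaloisGroup K) • m) :=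
  rfl

/-- The **action of the decomposition group `D_v` on `M ⧸ M⁺_v`** (Greenberg 1989 (4): `A/F⁺A` as a
`D_v`-module; EPW §3.1: the `𝒪[G_p]`-module `A''`). [cite: Greenberg1989, §1 p. 98 (4)] -/
instance instDistribMulActionGr : DistribMulAction (decomp v) N.Gr where
  smul δ x := N.grSMulHom δ x
  one_smul x := by
    obtain ⟨m, rfl⟩ := N.grMk_surjective x
    change N.grSMulHom 1 (N.grMk m) = N.grMk m
    rw [grSMulHom_grMk, OneMemClass.coe_one, one_smul]
  mul_smul δ δ' x := by
    obtain ⟨m, rfl⟩ := N.grMk_surjective x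
    change N.grSMulHom (δ * δ') (N.grMk m) = N.grSMulHom δ (N.grSMulHom δ' (N.grMk m))
    rw [grSMulHom_grMk, grSMulHom_grMk, grSMulHom_grMk, Subgroup.coe_mul, mul_smul]
  smul_zero δ := map_zero (N.grSMulHom δ)
  smul_add δ x y := map_add (N.grSMulHom δ) x y

/-- Unfolding the action on classes: `δ • (m mod M⁺) = (δ • m) mod M⁺`.
[cite: Greenberg1989, §1 p. 98 (4)] -/
@[simp]
theorem smul_grMk (δ : decomp v) (m : M) :
    δ • N.grMk m = N.grMk ((δ : absoluteGaloisGroup K) • m) :=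
  rfl

end LocalDatum

/-! ## The local groups of `L = K̄^H` above `v`, inside `D_v` -/

/-- The **inertia group of `L = K̄^H` at the place above `v`** singled out by the chosen embedding,
`I_w(L̄/L) = H ⊓ I_v`, as a subgroup of `D_v` (so that it acts on `M ⧸ M⁺_v`).
Greenberg 1989, p. 98 ("`I_v` … the inertia group for `v` in `G_{ℚ_∞}`"). [cite: Greenberg1989, §1 p. 98] -/
def inertiaIn (H : Subgroup (absoluteGaloisGroup K)) (v : HeightOneSpectrum (𝓞 K)) :
    Subgroup (decomp (K := K) v) :=
  (H ⊓ inertia v).subgroupOf (decomp v)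

/-- The **decomposition group of `L = K̄^H` at the place above `v`**, `D_w(L̄/L) = H ⊓ D_v`, as a
subgroup of `D_v`. Greenberg 1989, p. 98. [cite: Greenberg1989, §1 p. 98] -/
def decompIn (H : Subgroup (absoluteGaloisGroup K)) (v : HeightOneSpectrum (𝓞 K)) :
    Subgroup (decomp (K := K) v) :=
  (H ⊓ decomp v).subgroupOf (decomp v)

/-- Membership in `inertiaIn H v`: `x ∈ H` and `x ∈ I_v`. [cite: Greenberg1989, §1 p. 98] -/
theorem mem_inertiaIn_iff (H : Subgroup (absoluteGaloisGroup K)) (v : HeightOneSpectrum (𝓞 K))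
    (x : decomp (K := K) v) :
    x ∈ inertiaIn H v ↔ (x : absoluteGaloisGroup K) ∈ H ∧ (x : absoluteGaloisGroup K) ∈ inertia v :=
  Subgroup.mem_subgroupOf.trans Subgroup.mem_inf

/-- Membership in `decompIn H v`: `x ∈ H`. [cite: Greenberg1989, §1 p. 98] -/
theorem mem_decompIn_iff (H : Subgroup (absoluteGaloisGroup K)) (v : HeightOneSpectrum (𝓞 K))
    (x : decomp (K := K) v) :
    x ∈ decompIn H v ↔ (x : absoluteGaloisGroup K) ∈ H :=
  Subgroup.mem_subgroupOf.trans (by simp [Subgroup.mem_inf])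

/-- `H ⊓ I_v ≤ H ⊓ D_v` inside `D_v`. [cite: NeukirchANT1999, Ch. I §9 (Def. (9.5), `I_𝔓 ⊆ G_𝔓`)] -/
theorem inertiaIn_le_decompIn (H : Subgroup (absoluteGaloisGroup K))
    (v : HeightOneSpectrum (𝓞 K)) : inertiaIn H v ≤ decompIn H v :=
  fun x hx ↦ (mem_decompIn_iff H v x).2 ((mem_inertiaIn_iff H v x).1 hx).1

/-- The inclusion `H ⊓ D_v → H` as a continuous homomorphism (out of the subgroup `decompIn H v` of
`D_v`). [folklore] -/
def decompInToH (H : Subgroup (absoluteGaloisGroup K)) (v : HeightOneSpectrum (𝓞 K)) :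
    decompIn H v →ₜ* H where
  toFun x := ⟨((x : decomp (K := K) v) : absoluteGaloisGroup K), (mem_decompIn_iff H v x).1 x.2⟩
  map_one' := rfl
  map_mul' _ _ := rfl
  continuous_toFun :=
    (continuous_subtype_val.comp continuous_subtype_val).subtype_mk _

/-- The inclusion `H ⊓ I_v → H` as a continuous homomorphism. [folklore] -/
def inertiaInToH (H : Subgroup (absoluteGaloisGroup K)) (v : HeightOneSpectrum (𝓞 K)) :
    inertiaIn H v →ₜ* H :=
  (decompInToH H v).comp (Literature.NumberTheory.EllipticCurves.subgroupInclusion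
    (inertiaIn_le_decompIn H v))

/-! ## Local conditions -/

section Local

variable (H : Subgroup (absoluteGaloisGroup K)) (M : Type u) [AddCommGroup M]
  [DistribMulAction (absoluteGaloisGroup K) M] [TopologicalSpace M] [DiscreteTopology M]

/-- The local condition **at a finite place `v ∤ p`** (chosen place of `L` above `v`): the kernel of
the restriction `H¹(H, M) → H¹(H ⊓ D_v, M) = H¹(L_w, M)` — "locally trivial at `w`"
(EPW §3.1: `H¹_s(ℚ_{∞,v}, A) = H¹(ℚ_{∞,v}, A)` for `v ≠ v_p`; Greenberg 1989 (3) with `D_v` for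
`I_v`, loc. cit.). [cite: EmertonPollackWeston2006, §3.1] -/
def awayKer (v : HeightOneSpectrum (𝓞 K)) : AddSubgroup (subgroupH1 H M) :=
  (resOfLe M (inf_le_left : H ⊓ decomp v ≤ H)).ker

/-- The local condition **at an infinite place `w`**: the kernel of `H¹(H, M) → H¹(H ⊓ D_w, M)`
(Greenberg 1989 (3), "including the infinite places"; EPW §3.1, `Σ` contains all archimedean
places). [cite: Greenberg1989, §1 p. 98 (3)] -/
def infKer (w : InfinitePlace K) : AddSubgroup (subgroupH1 H M) :=
  (resOfLe M (inf_le_left : H ⊓ decompInf w ≤ H)).ker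

variable {M}

/-- **Greenberg's local map at `v ∣ p`**: `H¹(H, M) → H¹(H ⊓ I_v, M ⧸ M⁺_v)`, induced by the
compatible pair (`H ⊓ I_v ↪ H`, `M ↠ M ⧸ M⁺_v`) — the composite
`H¹(ℚ_∞, A) → H¹(I_{v_p}, A) → H¹(I_{v_p}, A/F⁺A)` of Greenberg 1989 (4); EPW §3.1
`H¹(ℚ_{∞,v_p}, A) → H¹(I_{v_p}, A'')`. [cite: Greenberg1989, §1 p. 98 (4)] -/
def _root_.Literature.NumberTheory.EllipticCurves.GreenbergSelmer.LocalDatum.greenbergMap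
    {v : HeightOneSpectrum (𝓞 K)} (N : LocalDatum K M v) :
    subgroupH1 H M →+ discreteH1 (inertiaIn H v) N.Gr :=
  resH1Hom (inertiaInToH H v) N.grMk fun _ _ ↦ rfl

/-- **Greenberg's local condition at `v ∣ p`**: the kernel of `greenbergMap`, i.e. the classes whose
restriction to the inertia group `H ⊓ I_v` dies in `H¹(H ⊓ I_v, M ⧸ M⁺_v)`.
[cite: Greenberg1989, §1 p. 98 (4)] -/
def _root_.Literature.NumberTheory.EllipticCurves.GreenbergSelmer.LocalDatum.greenbergKer
    {v : HeightOneSpectrum (𝓞 K)} (N : LocalDatum K M v) : AddSubgroup (subgroupH1 H M) :=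
  (N.greenbergMap H).ker

/-- The **strict local map at `v ∣ p`**: `H¹(H, M) → H¹(H ⊓ D_v, M ⧸ M⁺_v)` (decomposition group in
place of inertia group: "In (4), it will be useful at times to replace `I_v` by `D_v`. This will
define a possibly smaller subgroup … which we will call the 'strict' Selmer group", Greenberg 1989,
p. 98). [cite: Greenberg1989, §1 p. 98] -/
def _root_.Literature.NumberTheory.EllipticCurves.GreenbergSelmer.LocalDatum.strictMap
    {v : HeightOneSpectrum (𝓞 K)} (N : LocalDatum K M v) :
    subgroupH1 H M →+ discreteH1 (decompIn H v) N.Gr :=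
  resH1Hom (decompInToH H v) N.grMk fun _ _ ↦ rfl

/-- The **strict local condition at `v ∣ p`**: the kernel of `strictMap`. Greenberg 1989, p. 98.
[cite: Greenberg1989, §1 p. 98] -/
def _root_.Literature.NumberTheory.EllipticCurves.GreenbergSelmer.LocalDatum.strictKer
    {v : HeightOneSpectrum (𝓞 K)} (N : LocalDatum K M v) : AddSubgroup (subgroupH1 H M) :=
  (N.strictMap H).ker

/-- Membership in `greenbergKer`: the class dies in `H¹(H ⊓ I_v, M ⧸ M⁺_v)`.
[cite: Greenberg1989, §1 p. 98 (4)] -/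
theorem _root_.Literature.NumberTheory.EllipticCurves.GreenbergSelmer.LocalDatum.mem_greenbergKer_iff
    {v : HeightOneSpectrum (𝓞 K)} (N : LocalDatum K M v) (c : subgroupH1 H M) :
    c ∈ N.greenbergKer H ↔ N.greenbergMap H c = 0 :=
  Iff.rfl

/-- Membership in `strictKer`: the class dies in `H¹(H ⊓ D_v, M ⧸ M⁺_v)`.
[cite: Greenberg1989, §1 p. 98] -/
theorem _root_.Literature.NumberTheory.EllipticCurves.GreenbergSelmer.LocalDatum.mem_strictKer_iff
    {v : HeightOneSpectrum (𝓞 K)} (N : LocalDatum K M v) (c : subgroupH1 H M) :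
    c ∈ N.strictKer H ↔ N.strictMap H c = 0 :=
  Iff.rfl

/-- Restricting further from `H ⊓ D_v` to `H ⊓ I_v` takes the strict map to Greenberg's map
(`resH1Hom_comp`), so **the strict condition implies Greenberg's condition**. Greenberg 1989, p. 98
("a possibly smaller subgroup"). [cite: Greenberg1989, §1 p. 98] -/
theorem _root_.Literature.NumberTheory.EllipticCurves.GreenbergSelmer.LocalDatum.strictKer_le_greenbergKer
    {v : HeightOneSpectrum (𝓞 K)} (N : LocalDatum K M v) :
    N.strictKer H ≤ N.greenbergKer H := by
  intro c hc
  have hcomp : (resH1Hom (Literature.NumberTheory.EllipticCurves.subgroupInclusion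
        (inertiaIn_le_decompIn H v)) (AddMonoidHom.id N.Gr) (fun _ _ ↦ rfl)).comp
        (N.strictMap H) = N.greenbergMap H := by
    rw [LocalDatum.strictMap, LocalDatum.greenbergMap, resH1Hom_comp]
    exact resH1Hom_congr rfl (by ext; rfl) _ _
  rw [LocalDatum.mem_greenbergKer_iff, ← hcomp, AddMonoidHom.comp_apply,
    (N.mem_strictKer_iff H c).1 hc, map_zero]

end Local

/-! ## Greenberg's Selmer group over `L = K̄^H` -/

section Selmer

variable (H : Subgroup (absoluteGaloisGroup K)) [H.Normal] (M : Type u) [AddCommGroup M]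
  [DistribMulAction (absoluteGaloisGroup K) M] [TopologicalSpace M] [DiscreteTopology M]
  (p : ℕ) (L : Data K M p)

/-- **Greenberg's Selmer group `Sel(L, M) ⊆ H¹(H, M)`** of the discrete `Γ_K`-module `M` over
`L = K̄^H`, relative to the ordinary data `L = (M⁺_v)_{v ∣ p}`: the classes `c` such that, for
every `σ ∈ Γ_K`, `conj_σ c` is locally trivial at the chosen place above every finite `v ∤ p`
(`awayKer`) and every infinite place (`infKer`), and satisfies Greenberg's condition at the chosen
place above every `v ∣ p` (`greenbergKer`, for the datum `M⁺_v`). Conjugating by all `σ` imposes the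
conditions at *all* places of `L` (the places above `v` are the `Γ_K`-conjugates of the chosen one;
at `v ∣ p` the datum is transported along), as in `WeierstrassCurve.selmerGroupOver`.
Emerton–Pollack–Weston 2006, §3.1: `Sel(ℚ_∞, A) = ker (H¹(ℚ_∞, A) → ∏_v H¹_s(ℚ_{∞,v}, A))`;
Greenberg 1989, p. 98, (2)–(4); Skinner–Urban 2014, §3.1.3.
[cite: EmertonPollackWeston2006, §3.1] [cite: Greenberg1989, §1 p. 98 (2)–(4)] -/
def selmerGroupOver : AddSubgroup (subgroupH1 H M) :=
  ((⨅ (v : HeightOneSpectrum (𝓞 K)) (_ : ((p : ℕ) : 𝓞 K) ∉ v.asIdeal)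
      (σ : absoluteGaloisGroup K), (awayKer H M v).comap (conjH1 H M σ)) ⊓
    ⨅ (w : InfinitePlace K) (σ : absoluteGaloisGroup K), (infKer H M w).comap (conjH1 H M σ)) ⊓
  ⨅ (v : HeightOneSpectrum (𝓞 K)) (hv : ((p : ℕ) : 𝓞 K) ∈ v.asIdeal) (σ : absoluteGaloisGroup K),
    ((L v hv).greenbergKer H).comap (conjH1 H M σ)

/-- **Greenberg's strict Selmer group** over `L = K̄^H`: as `selmerGroupOver` with the strict
condition (`strictKer`, decomposition group) at the places above `p`. Greenberg 1989, p. 98.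
[cite: Greenberg1989, §1 p. 98] -/
def strictSelmerGroupOver : AddSubgroup (subgroupH1 H M) :=
  ((⨅ (v : HeightOneSpectrum (𝓞 K)) (_ : ((p : ℕ) : 𝓞 K) ∉ v.asIdeal)
      (σ : absoluteGaloisGroup K), (awayKer H M v).comap (conjH1 H M σ)) ⊓
    ⨅ (w : InfinitePlace K) (σ : absoluteGaloisGroup K), (infKer H M w).comap (conjH1 H M σ)) ⊓
  ⨅ (v : HeightOneSpectrum (𝓞 K)) (hv : ((p : ℕ) : 𝓞 K) ∈ v.asIdeal) (σ : absoluteGaloisGroup K),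
    ((L v hv).strictKer H).comap (conjH1 H M σ)

variable {H M p L}

/-- Membership in Greenberg's Selmer group. [cite: EmertonPollackWeston2006, §3.1] -/
theorem mem_selmerGroupOver_iff (c : subgroupH1 H M) :
    c ∈ selmerGroupOver H M p L ↔
      (∀ (v : HeightOneSpectrum (𝓞 K)), ((p : ℕ) : 𝓞 K) ∉ v.asIdeal →
          ∀ σ : absoluteGaloisGroup K, conjH1 H M σ c ∈ awayKer H M v) ∧
        (∀ (w : InfinitePlace K) (σ : absoluteGaloisGroup K), conjH1 H M σ c ∈ infKer H M w) ∧
        ∀ (v : HeightOneSpectrum (𝓞 K)) (hv : ((p : ℕ) : 𝓞 K) ∈ v.asIdeal)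
          (σ : absoluteGaloisGroup K), conjH1 H M σ c ∈ (L v hv).greenbergKer H := by
  simp only [selmerGroupOver, AddSubgroup.mem_inf, AddSubgroup.mem_iInf, AddSubgroup.mem_comap,
    and_assoc]

/-- Membership in the strict Selmer group. [cite: Greenberg1989, §1 p. 98] -/
theorem mem_strictSelmerGroupOver_iff (c : subgroupH1 H M) :
    c ∈ strictSelmerGroupOver H M p L ↔
      (∀ (v : HeightOneSpectrum (𝓞 K)), ((p : ℕ) : 𝓞 K) ∉ v.asIdeal →
          ∀ σ : absoluteGaloisGroup K, conjH1 H M σ c ∈ awayKer H M v) ∧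
        (∀ (w : InfinitePlace K) (σ : absoluteGaloisGroup K), conjH1 H M σ c ∈ infKer H M w) ∧
        ∀ (v : HeightOneSpectrum (𝓞 K)) (hv : ((p : ℕ) : 𝓞 K) ∈ v.asIdeal)
          (σ : absoluteGaloisGroup K), conjH1 H M σ c ∈ (L v hv).strictKer H := by
  simp only [strictSelmerGroupOver, AddSubgroup.mem_inf, AddSubgroup.mem_iInf,
    AddSubgroup.mem_comap, and_assoc]

/-- **The strict Selmer group is contained in Greenberg's Selmer group** ("a possibly smaller
subgroup of `H¹(ℚ_∞, A_p)`", Greenberg 1989, p. 98). [cite: Greenberg1989, §1 p. 98] -/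
theorem strictSelmerGroupOver_le : strictSelmerGroupOver H M p L ≤ selmerGroupOver H M p L := by
  intro c hc
  rw [mem_strictSelmerGroupOver_iff] at hc
  rw [mem_selmerGroupOver_iff]
  exact ⟨hc.1, hc.2.1, fun v hv σ ↦ (L v hv).strictKer_le_greenbergKer H (hc.2.2 v hv σ)⟩

/-- **`Sel(L, M)` is stable under the conjugation action of `Γ_K`** (so that `Γ_K/H = Gal(L/K)`
acts on it; for `L = K_∞` this is the `Γ`-action making the dual a `Λ`-module, EPW §3.1 "via the
natural action of `Γ`"): the family of local conditions is permuted by `γ`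
(`conjH1 (σ γ) = conjH1 σ ∘ conjH1 γ`, `conjH1_mul_holds`). [cite: EmertonPollackWeston2006, §3.1] -/
theorem conjH1_mem_selmerGroupOver (γ : absoluteGaloisGroup K) {c : subgroupH1 H M}
    (hc : c ∈ selmerGroupOver H M p L) : conjH1 H M γ c ∈ selmerGroupOver H M p L := by
  have e : ∀ σ : absoluteGaloisGroup K, conjH1 H M σ (conjH1 H M γ c) = conjH1 H M (σ * γ) c :=
    fun σ ↦ by rw [conjH1_mul_holds H M σ γ]; rfl
  rw [mem_selmerGroupOver_iff] at hc ⊢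
  refine ⟨fun v hv σ ↦ ?_, fun w σ ↦ ?_, fun v hv σ ↦ ?_⟩
  · rw [e]; exact hc.1 v hv (σ * γ)
  · rw [e]; exact hc.2.1 w (σ * γ)
  · rw [e]; exact hc.2.2 v hv (σ * γ)

/-- `Sel(L, M)` is mapped into itself by every `conj_γ` (subgroup form of
`conjH1_mem_selmerGroupOver`; compare `WeierstrassCurve.map_conjH1_selmerGroupOver_le`).
[cite: EmertonPollackWeston2006, §3.1] -/
theorem map_conjH1_selmerGroupOver_le (γ : absoluteGaloisGroup K) :
    (selmerGroupOver H M p L).map (conjH1 H M γ) ≤ selmerGroupOver H M p L := by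
  rintro _ ⟨c, hc, rfl⟩
  exact conjH1_mem_selmerGroupOver γ hc

/-- The strict Selmer group is stable under the conjugation action of `Γ_K`.
[cite: Greenberg1989, §1 p. 98] -/
theorem conjH1_mem_strictSelmerGroupOver (γ : absoluteGaloisGroup K) {c : subgroupH1 H M}
    (hc : c ∈ strictSelmerGroupOver H M p L) : conjH1 H M γ c ∈ strictSelmerGroupOver H M p L := by
  have e : ∀ σ : absoluteGaloisGroup K, conjH1 H M σ (conjH1 H M γ c) = conjH1 H M (σ * γ) c :=
    fun σ ↦ by rw [conjH1_mul_holds H M σ γ]; rfl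
  rw [mem_strictSelmerGroupOver_iff] at hc ⊢
  refine ⟨fun v hv σ ↦ ?_, fun w σ ↦ ?_, fun v hv σ ↦ ?_⟩
  · rw [e]; exact hc.1 v hv (σ * γ)
  · rw [e]; exact hc.2.1 w (σ * γ)
  · rw [e]; exact hc.2.2 v hv (σ * γ)

end Selmer

/-! ## Over a `ℤ_p`-extension: `Sel(K_∞, M)` -/

section Tower

variable {p : ℕ} [Fact p.Prime] (κ : ZpExtension K p) (M : Type u) [AddCommGroup M]
  [DistribMulAction (absoluteGaloisGroup K) M] [TopologicalSpace M] [DiscreteTopology M]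
  (L : Data K M p)

/-- **`Sel(K_∞, M)`**: Greenberg's Selmer group over the top `K_∞ = K̄^{ker κ}` of the
`ℤ_p`-extension `κ` (`selmerGroupOver` for the normal subgroup `ker κ`), inside
`H¹(K_∞, M) = subgroupH1 κ.kerSubgroup M`; `Γ = Gal(K_∞/K)` acts on it through `conjH1` — "We
regard `Sel(ℚ_∞, A)` as a `Λ_𝒪`-module via the natural action of `Γ`" (EPW §3.1); its Pontryagin
dual is the Iwasawa module whose characteristic power series carries `μ^alg`, `λ^alg`.
[cite: EmertonPollackWeston2006, §3.1] [cite: Greenberg1989, §1 p. 98 (2)] -/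
def selmerInfty : AddSubgroup (subgroupH1 κ.kerSubgroup M) :=
  selmerGroupOver κ.kerSubgroup M p L

/-- The strict Selmer group over `K_∞`. Greenberg 1989, p. 98. [cite: Greenberg1989, §1 p. 98] -/
def strictSelmerInfty : AddSubgroup (subgroupH1 κ.kerSubgroup M) :=
  strictSelmerGroupOver κ.kerSubgroup M p L

/-- `Sel^{str}(K_∞, M) ≤ Sel(K_∞, M)`. [cite: Greenberg1989, §1 p. 98] -/
theorem strictSelmerInfty_le : strictSelmerInfty κ M L ≤ selmerInfty κ M L :=
  strictSelmerGroupOver_le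

end Tower

/-! ## Scalars: the endomorphisms of `H¹(H, M)` induced by `Γ_K`-linear scalars of `M` -/

section Scalar

variable {G : Type u} [Group G] [TopologicalSpace G] [IsTopologicalGroup G] (H : Subgroup G)
  (M : Type u) [AddCommGroup M] [DistribMulAction G M] [TopologicalSpace M] [DiscreteTopology M]
  {R : Type*} [Monoid R] [DistribMulAction R M] [SMulCommClass G R M]

/-- The endomorphism of `H¹(H, M)` induced by the scalar `r ∈ R` (acting on `M` and commuting with
`G`): functoriality of `H¹(H, –)` along the `H`-equivariant map `m ↦ r • m` (`resH1Hom` for the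
pair `(id_H, r • ·)`). For `G = Γ_K` and `M = A` an `𝒪`-module with `𝒪`-linear Galois action this
is the `𝒪`-module structure of `H¹(K_∞, A)` making its dual a `Λ_𝒪 = 𝒪⟦T⟧`-module (EPW §3.1:
"We regard `Sel(ℚ_∞, A)` as a `Λ_𝒪`-module"). [cite: EmertonPollackWeston2006, §3.1] -/
def scalarH1 (r : R) : subgroupH1 H M →+ subgroupH1 H M :=
  resH1Hom (ContinuousMonoidHom.id H) (DistribSMul.toAddMonoidHom M r) fun x m ↦ by
    change r • ((x : G) • m) = (x : G) • (r • m)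
    exact (smul_comm (x : G) r m).symm

/-- The unit scalar induces the identity of `H¹(H, M)` (functoriality of cohomology in compatible
pairs, `resH1Hom_id`). [cite: NeukirchSchmidtWingberg2008, I.§5] -/
theorem scalarH1_one : scalarH1 H M (1 : R) = AddMonoidHom.id _ := by
  rw [scalarH1, resH1Hom_congr (ψ' := AddMonoidHom.id M) rfl (by ext m; simp) _ (fun _ _ ↦ rfl),
    resH1Hom_id]

/-- Scalars compose: `scalarH1 (r * r') = scalarH1 r ∘ scalarH1 r'` (functoriality of cohomology in
compatible pairs, `resH1Hom_comp`). [cite: NeukirchSchmidtWingberg2008, I.§5] -/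
theorem scalarH1_mul (r r' : R) :
    scalarH1 H M (r * r') = (scalarH1 H M r).comp (scalarH1 H M r') := by
  rw [scalarH1, scalarH1, scalarH1, resH1Hom_comp]
  exact resH1Hom_congr rfl (by ext m; simp [mul_smul]) _ _

end Scalar

/-! ## Scalars preserve the Selmer group -/

section ScalarStable

variable (H : Subgroup (absoluteGaloisGroup K)) {M : Type u} [AddCommGroup M]
  [DistribMulAction (absoluteGaloisGroup K) M] {R : Type*} [Monoid R] [DistribMulAction R M]

/-- The endomorphism of `M ⧸ M⁺_v` induced by a scalar `r` preserving `M⁺_v` (e.g. `r ∈ 𝒪` when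
`M⁺_v` is an `𝒪`-submodule, EPW §3.1: `A'`, `A''` are `𝒪[G_p]`-modules).
[cite: EmertonPollackWeston2006, §3.1] -/
def _root_.Literature.NumberTheory.EllipticCurves.GreenbergSelmer.LocalDatum.grScalarHom
    {v : HeightOneSpectrum (𝓞 K)} (N : LocalDatum K M v) (r : R)
    (hr : ∀ m ∈ N.plus, r • m ∈ N.plus) : N.Gr →+ N.Gr :=
  QuotientAddGroup.map N.plus N.plus (DistribSMul.toAddMonoidHom M r) hr

/-- `grScalarHom` on classes: `r · (m mod M⁺) = (r • m) mod M⁺`. [cite: EmertonPollackWeston2006, §3.1] -/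
@[simp]
theorem _root_.Literature.NumberTheory.EllipticCurves.GreenbergSelmer.LocalDatum.grScalarHom_grMk
    {v : HeightOneSpectrum (𝓞 K)} (N : LocalDatum K M v) (r : R)
    (hr : ∀ m ∈ N.plus, r • m ∈ N.plus) (m : M) :
    N.grScalarHom r hr (N.grMk m) = N.grMk (r • m) :=
  rfl

variable [SMulCommClass (absoluteGaloisGroup K) R M]

/-- The scalar endomorphism of `M ⧸ M⁺_v` commutes with the action of `D_v` (hence of `H ⊓ I_v`).
[cite: EmertonPollackWeston2006, §3.1] -/
theorem _root_.Literature.NumberTheory.EllipticCurves.GreenbergSelmer.LocalDatum.grScalarHom_smul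
    {v : HeightOneSpectrum (𝓞 K)} (N : LocalDatum K M v) (r : R)
    (hr : ∀ m ∈ N.plus, r • m ∈ N.plus) (x : inertiaIn H v) (q : N.Gr) :
    N.grScalarHom r hr (x • q) = x • N.grScalarHom r hr q := by
  obtain ⟨m, rfl⟩ := N.grMk_surjective q
  change N.grScalarHom r hr ((x : decomp (K := K) v) • N.grMk m) =
    (x : decomp (K := K) v) • N.grScalarHom r hr (N.grMk m)
  rw [N.smul_grMk, N.grScalarHom_grMk, N.grScalarHom_grMk, N.smul_grMk,
    smul_comm ((x : decomp (K := K) v) : absoluteGaloisGroup K) r m]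

variable [TopologicalSpace M] [DiscreteTopology M]

omit [NumberField K] in
/-- Conjugation commutes with scalars on `H¹(H, M)`: both composites are induced by the compatible
pair `(h ↦ σ⁻¹ h σ, m ↦ σ • r • m = r • σ • m)` (functoriality, `resH1Hom_comp`).
[cite: NeukirchSchmidtWingberg2008, I.§5] -/
theorem conjH1_comp_scalarH1 [H.Normal] (σ : absoluteGaloisGroup K) (r : R) :
    (conjH1 H M σ).comp (scalarH1 H M r) = (scalarH1 H M r).comp (conjH1 H M σ) := by
  rw [scalarH1, conjH1, resH1Hom_comp, resH1Hom_comp]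
  exact resH1Hom_congr (by ext; rfl) (by ext m; simp [smul_comm]) _ _

omit [NumberField K] in
/-- Restriction commutes with scalars (functoriality, `resH1Hom_comp`).
[cite: NeukirchSchmidtWingberg2008, I.§5] -/
theorem resOfLe_comp_scalarH1 {H H' : Subgroup (absoluteGaloisGroup K)} (h : H ≤ H') (r : R) :
    (resOfLe M h).comp (scalarH1 H' M r) = (scalarH1 H M r).comp (resOfLe M h) := by
  rw [scalarH1, scalarH1, resOfLe, resH1Hom_comp, resH1Hom_comp]
  exact resH1Hom_congr (by ext; rfl) (by ext; rfl) _ _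

/-- **Greenberg's local map commutes with scalars**: for `r` preserving `M⁺_v`,
`gr ∘ scalarH1 r = H¹(r) ∘ gr`, both composites being induced by the compatible pair
(`H ⊓ I_v ↪ H`, `m ↦ (r • m) mod M⁺_v`). [cite: NeukirchSchmidtWingberg2008, I.§5] -/
theorem _root_.Literature.NumberTheory.EllipticCurves.GreenbergSelmer.LocalDatum.greenbergMap_comp_scalarH1
    {v : HeightOneSpectrum (𝓞 K)} (N : LocalDatum K M v) (r : R)
    (hr : ∀ m ∈ N.plus, r • m ∈ N.plus) :
    (N.greenbergMap H).comp (scalarH1 H M r) =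
      (resH1Hom (ContinuousMonoidHom.id (inertiaIn H v)) (N.grScalarHom r hr)
        (fun x q ↦ N.grScalarHom_smul H r hr x q)).comp (N.greenbergMap H) := by
  rw [scalarH1, LocalDatum.greenbergMap, resH1Hom_comp, resH1Hom_comp]
  exact resH1Hom_congr (by ext; rfl) (by ext; rfl) _ _

/-- Scalars preserving `M⁺_v` preserve Greenberg's local condition at `v`.
[cite: EmertonPollackWeston2006, §3.1] -/
theorem _root_.Literature.NumberTheory.EllipticCurves.GreenbergSelmer.LocalDatum.scalarH1_mem_greenbergKer
    {v : HeightOneSpectrum (𝓞 K)} (N : LocalDatum K M v) (r : R)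
    (hr : ∀ m ∈ N.plus, r • m ∈ N.plus) {c : subgroupH1 H M} (hc : c ∈ N.greenbergKer H) :
    scalarH1 H M r c ∈ N.greenbergKer H := by
  rw [LocalDatum.mem_greenbergKer_iff, ← AddMonoidHom.comp_apply,
    N.greenbergMap_comp_scalarH1 H r hr, AddMonoidHom.comp_apply,
    (N.mem_greenbergKer_iff H c).1 hc, map_zero]

variable (M) in
/-- Scalars preserve the local conditions away from `p` (`awayKer`). [cite: EmertonPollackWeston2006, §3.1] -/
theorem scalarH1_mem_awayKer (v : HeightOneSpectrum (𝓞 K)) (r : R) {c : subgroupH1 H M}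
    (hc : c ∈ awayKer H M v) : scalarH1 H M r c ∈ awayKer H M v := by
  rw [awayKer, AddMonoidHom.mem_ker, ← AddMonoidHom.comp_apply, resOfLe_comp_scalarH1,
    AddMonoidHom.comp_apply, (AddMonoidHom.mem_ker.1 hc : resOfLe M _ c = 0), map_zero]

omit [NumberField K] in
variable (M) in
/-- Scalars preserve the local conditions at the infinite places (`infKer`).
[cite: EmertonPollackWeston2006, §3.1] -/
theorem scalarH1_mem_infKer (w : InfinitePlace K) (r : R) {c : subgroupH1 H M}
    (hc : c ∈ infKer H M w) : scalarH1 H M r c ∈ infKer H M w := by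
  rw [infKer, AddMonoidHom.mem_ker, ← AddMonoidHom.comp_apply, resOfLe_comp_scalarH1,
    AddMonoidHom.comp_apply, (AddMonoidHom.mem_ker.1 hc : resOfLe M _ c = 0), map_zero]

/-- **Scalars preserve Greenberg's Selmer group**: if `r` preserves every `M⁺_v`, `v ∣ p`, then
`scalarH1 r` maps `Sel(L, M)` into itself — for `M = A` an `𝒪`-module with `𝒪`-linear action and
`𝒪`-submodules `A'_v`, this is the `𝒪`-module structure of `Sel(ℚ_∞, A)` (EPW §3.1: "We regard
`Sel(ℚ_∞, A_{f,i})` as a `Λ_𝒪`-module"). [cite: EmertonPollackWeston2006, §3.1] -/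
theorem scalarH1_mem_selmerGroupOver [H.Normal] {p : ℕ} {L : Data K M p} (r : R)
    (hr : ∀ (v : HeightOneSpectrum (𝓞 K)) (hv : ((p : ℕ) : 𝓞 K) ∈ v.asIdeal),
      ∀ m ∈ (L v hv).plus, r • m ∈ (L v hv).plus)
    {c : subgroupH1 H M} (hc : c ∈ selmerGroupOver H M p L) :
    scalarH1 H M r c ∈ selmerGroupOver H M p L := by
  have e : ∀ σ : absoluteGaloisGroup K,
      conjH1 H M σ (scalarH1 H M r c) = scalarH1 H M r (conjH1 H M σ c) :=
    fun σ ↦ by rw [← AddMonoidHom.comp_apply, conjH1_comp_scalarH1, AddMonoidHom.comp_apply]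
  rw [mem_selmerGroupOver_iff] at hc ⊢
  refine ⟨fun v hv σ ↦ ?_, fun w σ ↦ ?_, fun v hv σ ↦ ?_⟩
  · rw [e]; exact scalarH1_mem_awayKer H M v r (hc.1 v hv σ)
  · rw [e]; exact scalarH1_mem_infKer H M w r (hc.2.1 w σ)
  · rw [e]; exact (L v hv).scalarH1_mem_greenbergKer H r (hr v hv) (hc.2.2 v hv σ)

end ScalarStable

end Literature.NumberTheory.EllipticCurves.GreenbergSelmer

end
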